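import Mathlib
import Summits.Ventures.PercRepro2.SLevelCD

/-!
# (SC1) — the FIRST-ORDER form of (CD), at `S`-level (blind cell PercRepro2, mine-a g13;
MINE-A.md §56.2; INBOX 2026-08-25T08:1xZ)

Reveal `S = C(a₁)` under `Q = {a₁ ↮ a₂}` (typer-1's `SLevel` objects: `covS F G = P(Q)² Cov_{S∼Q}(F, G)`
cleared, `hS x S = P_{G∖S}(x ∈ C(a₂))`, `indS x S = 1[x ∈ S]`).  Two further marks `y, o ∉ {a₁, a₂}`.

* `Go = E[(1[o ∈ C₁] + h_o(C₁)) · 1_Q] = P(Q, o ∈ C₁) + P(Q, o ∈ C₂) = P(Q) · γ₀`, the cleared form of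
  `γ₀ = P_Q(o ∈ C₁ ∪ C₂)` (the identity `E[1_Q h_o(C₁)] = P(Q, o ∈ C₂)` is the tree's `delClusterProb`
  mixture; it is not needed below);
* `psi S = 1[y ∈ S] · (Go − P(Q) · h_o(S)) = P(Q) · 1[y ∈ S] · (γ₀ − h_o(S))`.

**(SC1)**: `0 ≤ covS F psi` for EVERY increasing `F` of the revealed cluster, i.e.
`Cov_{S∼Q}(F, 1[y ∈ S]·(γ₀ − h_o(S))) ≥ 0`, i.e. for every up-set `U` of `C₁`
`Cov_Q(U, 1[y ∈ C₁]·1[o ∈ C₂]) ≤ P_Q(o ∈ C₁ ∪ C₂) · Cov_Q(U, 1[y ∈ C₁])`.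
It is the `p → 0` tangent of (CD) for `a₃` pendant at `y` with weight `p` (paper: MINE-A.md §56.2,
`tangent.py`), and the first-order (CD) for every `a₃` with all its edge weights scaled to `0`
(`Σ_y p_{y a₃} · (SC1)_y`).  A definition only (CANDIDATE: exhaustive binary-extreme `n = 6`, all
`5 ≤ m ≤ 10`, both palettes, ALL up-sets by max-flow closure, `0 / 11,731,584` live instances per
palette, kit j236091; `n = 5` all weights as a corollary of the typed (CD) on `6` vertices).
* the pointwise regime `P(Q) · h_o(W) ≤ Go` on `{W ∋ y}` implies (SC1) (`sc1_of_regime`: `psi` is then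
  increasing and nonnegative, BHK06 Thm 1.3 on `C₁`, `covS_nonneg_of_monotone`); (SC1) is the statement
  that survives OUTSIDE the regime;
* every up-set `𝓤` gives the per-up-set form `0 ≤ covS 1_𝓤 psi` (`sc1_upset`), and `F = indS b` the
  first-order (i) (`sc1_indS`).
Nothing about (SC1) itself is claimed. -/

namespace Summit.Ventures.PercRepro2

open UnionCluster

namespace SLevel

section SC1

variable {V : Type*} {E : Type*} [Fintype E] [DecidableEq E] [Fintype V] [DecidableEq V]
  {R : Type*} [Field R] [LinearOrder R] [IsStrictOrderedRing R]

variable (p : E → R) (ends : E → Sym2 V) (o a₁ a₂ y b : V)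

local notation3 "Q" => avoidAll ends a₂ {a₁}
local notation3 "𝟙Q" => (avoidAll ends a₂ {a₁}).indicator (1 : Config E → R)

omit [Fintype V] [DecidableEq V] [LinearOrder R] [IsStrictOrderedRing R] in
/-- `Go = E[(1[o ∈ C₁] + h_o(C₁)) 1_Q] = P(Q)·γ₀`, the cleared root-connection probability of `o` under `Q`. -/
noncomputable def Go : R :=
  expect p (fun ω => (indS o (cluster ends ω a₁) + hS p ends a₂ o (cluster ends ω a₁)) * 𝟙Q ω)

omit [Fintype V] [DecidableEq V] [LinearOrder R] [IsStrictOrderedRing R] in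
/-- `psi S = 1[y ∈ S] · (Go − P(Q) · h_o(S)) = P(Q) · 1[y ∈ S] · (γ₀ − h_o(S))`. -/
noncomputable def psi (S : Set V) : R :=
  indS y S * (Go p ends o a₁ a₂ - prob p Q * hS p ends a₂ o S)

omit [Fintype V] [DecidableEq V] [LinearOrder R] [IsStrictOrderedRing R] in
/-- **(SC1)**: `0 ≤ covS F psi` for every increasing `F : Set V → R` (mine-a g13 candidate; MINE-A.md §56.2). -/
def SC1 : Prop :=
  ∀ F : Set V → R, Monotone F → 0 ≤ covS p ends a₁ a₂ F (psi p ends o a₁ a₂ y)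

omit [Fintype V] [DecidableEq V] in
/-- In the pointwise regime `P(Q)·h_o(W) ≤ Go` on `{W ∋ y}`, `psi` is nonnegative. -/
lemma psi_nonneg_of_regime (hreg : ∀ W : Set V, y ∈ W → prob p Q * hS p ends a₂ o W ≤ Go p ends o a₁ a₂)
    (W : Set V) : 0 ≤ psi p ends o a₁ a₂ y W := by
  unfold psi indS
  by_cases hW : y ∈ W
  · rw [Set.indicator_of_mem (show W ∈ {W : Set V | y ∈ W} from hW)]
    simp only [Pi.one_apply, one_mul]
    linarith [hreg W hW]
  · rw [Set.indicator_of_notMem (show W ∉ {W : Set V | y ∈ W} from hW), zero_mul]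

omit [Fintype V] [DecidableEq V] in
/-- In the pointwise regime `psi` is increasing (`h_o` is antitone, the indicator jumps upward to a
nonnegative value). -/
lemma psi_monotone_of_regime (hp : IsProbVec p)
    (hreg : ∀ W : Set V, y ∈ W → prob p Q * hS p ends a₂ o W ≤ Go p ends o a₁ a₂) :
    Monotone (psi p ends o a₁ a₂ y) := by
  have hgo : Antitone (hS p ends a₂ o) := delClusterProb_anti p hp ends a₂ (isUpperSet_mem_setOf o)
  have hQ : 0 ≤ prob p Q := prob_nonneg hp _
  intro W W' hWW'
  by_cases hW : y ∈ W
  · have hW' : y ∈ W' := hWW' hW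
    simp only [psi, indS]
    rw [Set.indicator_of_mem (show W ∈ {W : Set V | y ∈ W} from hW),
      Set.indicator_of_mem (show W' ∈ {W : Set V | y ∈ W} from hW')]
    simp only [Pi.one_apply, one_mul]
    have := hgo hWW'
    nlinarith [this, hQ]
  · have h0 : psi p ends o a₁ a₂ y W = 0 := by
      unfold psi indS
      rw [Set.indicator_of_notMem (show W ∉ {W : Set V | y ∈ W} from hW), zero_mul]
    rw [h0]
    exact psi_nonneg_of_regime p ends o a₁ a₂ y hreg W'

/-- **The pointwise regime implies (SC1)**: if `P(Q)·h_o(W) ≤ Go` on every `W ∋ y`, then `psi` is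
increasing and nonnegative, and BHK06 Thm 1.3 on `C₁` (`covS_nonneg_of_monotone`, after centring `F`
at `F ∅ ≤ F W`) gives `0 ≤ covS F psi` for every increasing `F`. -/
theorem sc1_of_regime (hp : IsProbVec p)
    (hreg : ∀ W : Set V, y ∈ W → prob p Q * hS p ends a₂ o W ≤ Go p ends o a₁ a₂) :
    SC1 p ends o a₁ a₂ y := by
  intro F hF
  have hF' : Monotone (fun W : Set V => F W - F ∅) := fun W W' h => by
    show F W - F ∅ ≤ F W' - F ∅
    linarith [hF h]
  have hF'0 : ∀ W : Set V, 0 ≤ F W - F ∅ := fun W => by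
    linarith [hF (Set.empty_subset W)]
  have h := covS_nonneg_of_monotone p ends a₁ a₂ hp hF'
    (psi_monotone_of_regime p ends o a₁ a₂ y hp hreg) hF'0
    (psi_nonneg_of_regime p ends o a₁ a₂ y hreg)
  rw [covS_sub_const_left] at h
  exact h

omit [Fintype V] [DecidableEq V] in
/-- **(SC1) for an up-set**: `0 ≤ covS 1_𝓤 psi` for every up-set `𝓤` of vertex sets. -/
theorem sc1_upset (h : SC1 p ends o a₁ a₂ y) {𝓤 : Set (Set V)} (h𝓤 : IsUpperSet 𝓤) :
    0 ≤ covS p ends a₁ a₂ (𝓤.indicator (1 : Set V → R)) (psi p ends o a₁ a₂ y) :=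
  h _ (monotone_indicator_one_of_isUpperSet h𝓤)

omit [Fintype V] [DecidableEq V] in
/-- **(SC1) ⟹ the first-order (i)**: `0 ≤ covS (1[b ∈ ·]) psi`. -/
theorem sc1_indS (h : SC1 p ends o a₁ a₂ y) :
    0 ≤ covS p ends a₁ a₂ (indS b) (psi p ends o a₁ a₂ y) :=
  h _ (indS_monotone b)

end SC1

end SLevel

end Summit.Ventures.PercRepro2
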